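import Literature.MathematicalPhysics.QuantumLattice.Imbrie2016.MonomerGapLaw

/-!
# Imbrie (2016), Assumption LLA at sub-coupling ("super-deep") scales: the typed shape (DEEP), its budget
# arithmetic against the residue, and the one-site instance — kernel-checked

CITATION HEADER (lean-in-tree rule 2026-08-18). J. Z. Imbrie, *On many-body localization for quantum spin chains*,
J. Stat. Phys. **163** (2016) 998–1048, doi 10.1007/s10955-016-1508-x, arXiv:1403.7837 [ImbrieJSP2016]: eq. (1.1) (model,
+ boundary condition), p. 1000 (admissible laws: densities ≤ ρ₀ on [-1,1]), eq. (1.3) (Assumption LLA(ν, C)), §4.2.1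
eqs. (4.19)–(4.21) (block-occurrence bookkeeping (cρ₁ε^s)^{V/8}), §5 proof of Thm 5.1 (the consumed test min gap ≥ ε^{sϰn},
charged ε^{sνϰn}; ε = γ^{1/20}).

WHAT IS TYPED (audit cell `pub-imbrie`, seat 1 gen 14, LLA.md block WH; hypothesis SHAPES, never asserted):
* `DeepLLA L γ ν₁ K A Θ₁` — the SUPER-DEEP FRAGMENT of LLA with γ-polynomial per-site constants: for every box of n sites and
  every 0 < δ ≤ γ^{Θ₁ n}:  P(min-gap < δ) ≤ δ^{ν₁} (K γ^{-A})^n.  (LLA(ν, C) is the case Θ₁ = 0, A = 0, K = C: `deepLLA_of_LLA`.)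
* `ResidueShape L γ ν Θ` — for every box of n sites and every 0 < δ ≤ γ^{Θ n}:  P(min-gap < δ) ≤ δ^ν.  With Θ = s/(160ν) this is,
  box for box, the inequality the audit's irreducible residue asks of a DRESSED fully-resonant core of V = n sites (LLA.md §3
  P4(f) / REPAIR-CENSUS V12: threshold ε̃_c^V with ε̃_c ≤ ε^{s/(8ν)} = γ^{s/(160ν)}, budget ε̃_c^{νV}); the dressing by the collar is
  NOT typed here, so both predicates are the BARE-BOX proxies of the residue, exactly as `LLA` is the bare-box statement (1.3).
WHAT IS PROVED (elementary; no statement of the paper is touched):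
* `deep_budget_le` — the absorption arithmetic of LLA.md WH1(c): if ν < ν₁, A < Θ(ν₁ − ν) and K ≤ γ^{-(Θ(ν₁−ν) − A)} (i.e. γ
  small), then for every V and every 0 < δ ≤ γ^{Θ V}:  δ^{ν₁} (K γ^{-A})^V ≤ δ^ν  — a per-site loss γ^{-A} and any K are paid for by
  the depth of the threshold;  `residueShape_of_deepLLA` — hence DeepLLA(ν₁, K, A, Θ₁) ⟹ ResidueShape(ν, Θ) for Θ ≥ Θ₁ under the
  same side conditions (0 < γ < 1).
* the ONE-SITE INSTANCE with exponent 2 ("level repulsion below the coupling"): `two_mul_abs_coupling_lt_of_smallGap` (the small-gap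
  event forces 2|γΓ₀| < δ as well as 2|h_eff| < δ, the gap being 2√(h_eff² + γ²Γ₀²)), `volume_deepSlab_one_le` (Fubini:
  Leb{|h₀+J₀+J₁| < δ/2, |γΓ₀| < δ/2} ∩ cube ≤ 4δ²/|γ|), `boxMeasure_smallGap_one_deep_le` (P ≤ ρ₀⁴·4δ²/|γ| for γ ≠ 0, all δ ≥ 0),
  `boxMeasure_smallGap_one_le_min` (with `MonomerGapLaw`: P ≤ min(ρ₀⁴·8δ, ρ₀⁴·4δ²/|γ|)), `deepLLA_clause_one` (the n = 1 clause of
  `DeepLLA L γ 2 (4ρ₀⁴) 1 Θ₁`, every Θ₁, every γ > 0).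
MEANING. The n = 1 law has exponent 2 with per-site constant ∝ γ^{-1}: the shape (DEEP) with ν₁ = 2, A = 1 — codimension two
(detuning AND coupling small).  Nothing here is evidence for `DeepLLA` at n ≥ 2, which — like LLA — is an OPEN, UNPROVED hypothesis
shape; Theorem 1.1 of [ImbrieJSP2016] remains conditional.  No `sorry`, no new axioms.
-/

noncomputable section

namespace Literature.MathematicalPhysics.QuantumLattice.Imbrie2016

open _root_.MeasureTheory Set

/-! ### The typed shapes -/

/-- **(DEEP) — the super-deep fragment of LLA with γ-polynomial constants** (audit shape, LLA.md WH1; bare-box proxy of what the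
residue consumes): for every box [a, a+n−1], n ≥ 1, and every 0 < δ ≤ γ^{Θ₁ n}, P(min-gap < δ) ≤ δ^{ν₁} (K γ^{-A})^n.
UNPROVED hypothesis shape for n ≥ 2; never asserted. [cite: ImbrieJSP2016, eq. (1.3)] -/
def DeepLLA (L : Laws) (γ ν₁ K A Θ₁ : ℝ) : Prop :=
  ∀ (a : ℤ) (n : ℕ), 0 < n → ∀ δ : ℝ, 0 < δ → δ ≤ γ ^ (Θ₁ * n) →
    L.boxMeasure a n {t | SmallGap γ δ (Params.ofTriple t)} ≤ ENNReal.ofReal (δ ^ ν₁ * (K * γ ^ (-A)) ^ n)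

/-- **(RES_ν at depth Θ)** (audit shape, LLA.md WH1; bare-box proxy): for every box of n ≥ 1 sites and every 0 < δ ≤ γ^{Θ n},
P(min-gap < δ) ≤ δ^ν.  With Θ = s/(160ν) this is the inequality REPAIR-CENSUS V12 asks of a dressed fully-resonant core of n sites.
UNPROVED hypothesis shape; never asserted. [cite: ImbrieJSP2016, eq. (1.3), §4.2.1 (4.19)–(4.21), §5 proof of Thm 5.1] -/
def ResidueShape (L : Laws) (γ ν Θ : ℝ) : Prop :=
  ∀ (a : ℤ) (n : ℕ), 0 < n → ∀ δ : ℝ, 0 < δ → δ ≤ γ ^ (Θ * n) →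
    L.boxMeasure a n {t | SmallGap γ δ (Params.ofTriple t)} ≤ ENNReal.ofReal (δ ^ ν)

/-- LLA(ν, C) is (DEEP) with no depth restriction used and no γ-loss: `LLA L γ ν C → DeepLLA L γ ν C 0 Θ₁` for every Θ₁.
[cite: ImbrieJSP2016, eq. (1.3)] -/
theorem deepLLA_of_LLA {L : Laws} {γ ν C : ℝ} (Θ₁ : ℝ) (h : LLA L γ ν C) :
    DeepLLA L γ ν C 0 Θ₁ := by
  intro a n hn δ hδ _
  have e : (C * γ ^ (-(0 : ℝ))) ^ n = C ^ n := by
    rw [neg_zero, Real.rpow_zero, mul_one]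
  rw [e]
  exact h a n hn δ hδ

/-! ### The budget arithmetic of the residue (LLA.md WH1(c)) -/

/-- **Absorption of per-site losses by depth.**  For 0 < γ, ν < ν₁, A < Θ(ν₁ − ν) and K ≤ γ^{-(Θ(ν₁−ν) − A)} (true for all
small γ once the exponent is positive), every V and every 0 < δ ≤ γ^{Θ V}:  δ^{ν₁} · (K γ^{-A})^V ≤ δ^ν.
Proof: δ^{ν₁−ν} ≤ γ^{ΘV(ν₁−ν)} and (Kγ^{-A})^V ≤ γ^{-ΘV(ν₁−ν)}. [cite: ImbrieJSP2016, §5 proof of Thm 5.1 (exponent bookkeeping)] -/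
theorem deep_budget_le {γ δ ν ν₁ K A Θ : ℝ} (hγ : 0 < γ) (hν : ν < ν₁) (hK : 0 < K)
    (hKγ : K ≤ γ ^ (-(Θ * (ν₁ - ν) - A))) (V : ℕ) (hδ : 0 < δ) (hδΘ : δ ≤ γ ^ (Θ * V)) :
    δ ^ ν₁ * (K * γ ^ (-A)) ^ V ≤ δ ^ ν := by
  have hd : 0 ≤ ν₁ - ν := (sub_pos.mpr hν).le
  -- split δ^{ν₁} = δ^ν · δ^{ν₁-ν}
  have e1 : δ ^ ν₁ = δ ^ ν * δ ^ (ν₁ - ν) := by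
    rw [← Real.rpow_add hδ]; congr 1; ring
  -- depth: δ^{ν₁-ν} ≤ γ^{Θ V (ν₁-ν)}
  have h1 : δ ^ (ν₁ - ν) ≤ γ ^ (Θ * V * (ν₁ - ν)) := by
    calc δ ^ (ν₁ - ν) ≤ (γ ^ (Θ * V)) ^ (ν₁ - ν) := Real.rpow_le_rpow hδ.le hδΘ hd
      _ = γ ^ (Θ * V * (ν₁ - ν)) := by rw [← Real.rpow_mul hγ.le]
  -- loss: (K γ^{-A})^V ≤ γ^{-Θ V (ν₁-ν)}
  have h2 : K * γ ^ (-A) ≤ γ ^ (-(Θ * (ν₁ - ν))) := by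
    calc K * γ ^ (-A) ≤ γ ^ (-(Θ * (ν₁ - ν) - A)) * γ ^ (-A) :=
          mul_le_mul_of_nonneg_right hKγ (Real.rpow_nonneg hγ.le _)
      _ = γ ^ (-(Θ * (ν₁ - ν))) := by rw [← Real.rpow_add hγ]; congr 1; ring
  have h3 : (K * γ ^ (-A)) ^ V ≤ γ ^ (-(Θ * V * (ν₁ - ν))) := by
    calc (K * γ ^ (-A)) ^ V ≤ (γ ^ (-(Θ * (ν₁ - ν)))) ^ V :=
          pow_le_pow_left₀ (by positivity) h2 V
      _ = γ ^ (-(Θ * V * (ν₁ - ν))) := by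
          rw [← Real.rpow_natCast (γ ^ (-(Θ * (ν₁ - ν)))) V, ← Real.rpow_mul hγ.le]; congr 1; ring
  have h4 : δ ^ (ν₁ - ν) * (K * γ ^ (-A)) ^ V ≤ 1 := by
    calc δ ^ (ν₁ - ν) * (K * γ ^ (-A)) ^ V ≤ γ ^ (Θ * V * (ν₁ - ν)) * γ ^ (-(Θ * V * (ν₁ - ν))) :=
          mul_le_mul h1 h3 (by positivity) (Real.rpow_nonneg hγ.le _)
      _ = 1 := by rw [← Real.rpow_add hγ, add_neg_cancel, Real.rpow_zero]
  calc δ ^ ν₁ * (K * γ ^ (-A)) ^ V = δ ^ ν * (δ ^ (ν₁ - ν) * (K * γ ^ (-A)) ^ V) := by rw [e1, mul_assoc]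
    _ ≤ δ ^ ν * 1 := mul_le_mul_of_nonneg_left h4 (Real.rpow_nonneg hδ.le _)
    _ = δ ^ ν := mul_one _

/-- **(DEEP) ⟹ (RES_ν at depth Θ)** for the bare-box proxies, under the side conditions of `deep_budget_le` and Θ₁ ≤ Θ
(0 < γ < 1, so that δ ≤ γ^{Θ n} ≤ γ^{Θ₁ n}).  With Θ = s/(160ν), every side condition holds for all sufficiently small ν and γ
because Θ(ν₁ − ν) = s(ν₁ − ν)/(160ν) → ∞ as ν ↓ 0 (LLA.md WH1(c)).  Hypotheses only; neither side is asserted.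
[cite: ImbrieJSP2016, §5 proof of Thm 5.1; §4.2.1 (4.19)–(4.21)] -/
theorem residueShape_of_deepLLA {L : Laws} {γ ν ν₁ K A Θ₁ Θ : ℝ} (hγ : 0 < γ) (hγ1 : γ < 1) (hν : ν < ν₁)
    (hK : 0 < K) (hΘ : Θ₁ ≤ Θ) (hKγ : K ≤ γ ^ (-(Θ * (ν₁ - ν) - A))) (h : DeepLLA L γ ν₁ K A Θ₁) :
    ResidueShape L γ ν Θ := by
  intro a n hn δ hδ hδΘ
  have hdeep : δ ≤ γ ^ (Θ₁ * n) := by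
    refine hδΘ.trans ?_
    apply Real.rpow_le_rpow_of_exponent_ge hγ hγ1.le
    exact mul_le_mul_of_nonneg_right hΘ (Nat.cast_nonneg n)
  refine (h a n hn δ hδ hdeep).trans ?_
  exact ENNReal.ofReal_le_ofReal (deep_budget_le hγ hν hK hKγ n hδ hδΘ)

/-! ### The one-site instance: exponent 2 below the coupling -/

section DeepMonomer

/-- [cite: ImbrieJSP2016, eq. (1.1) and (1.3)] **on one site the small-gap event also forces a small COUPLING**: if two distinct
eigen-indices are closer than `δ` then `2|γΓ₀| < δ` (gap `= 2√(h_eff² + γ²Γ₀²) ≥ 2|γΓ₀|`), for every `γ`. -/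
theorem two_mul_abs_coupling_lt_of_smallGap (γ : ℝ) (p : Params 1) {δ : ℝ} (h : SmallGap γ δ p) :
    2 * |γ * p.Γ 0| < δ := by
  obtain ⟨α, β, hne, hlt⟩ := h
  have hsum : eigs γ p α + eigs γ p β = 0 := by
    have hs := eigs_one_sum γ p
    rw [sum_cfg_one] at hs
    rcases cfg_one_eq α with rfl | rfl <;> rcases cfg_one_eq β with rfl | rfl
    · exact absurd rfl hne
    · exact hs
    · rw [add_comm]; exact hs
    · exact absurd rfl hne
  have hβ : eigs γ p β = -eigs γ p α := by linarith
  rw [hβ, sub_neg_eq_add, ← two_mul, abs_mul, abs_two] at hlt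
  have hle : |γ * p.Γ 0| ≤ |eigs γ p α| := by
    rw [← sq_le_sq, eigs_one_sq]
    nlinarith [sq_nonneg (heff p)]
  linarith

/-- [cite: ImbrieJSP2016, eq. (1.3)] in coordinates `t = (h, Γ, J)`: the one-site small-gap event lies in the codimension-two
tube `|h₀ + J₀ + J₁| < δ/2 ∧ |γΓ₀| < δ/2`. -/
theorem smallGap_one_subset_deep (γ δ : ℝ) :
    {t : (Fin 1 → ℝ) × (Fin 1 → ℝ) × (Fin (1 + 1) → ℝ) | SmallGap γ δ (Params.ofTriple t)} ⊆
      {t | |t.1 0 + t.2.2 0 + t.2.2 1| < δ / 2 ∧ |γ * t.2.1 0| < δ / 2} := by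
  intro t ht
  have h1 := two_mul_abs_heff_lt_of_smallGap γ (Params.ofTriple t) ht
  have h2 := two_mul_abs_coupling_lt_of_smallGap γ (Params.ofTriple t) ht
  simp only [heff, Params.ofTriple, Set.mem_setOf_eq] at h1 h2 ⊢
  constructor <;> linarith

/-- the `Γ₀`-section `{|γ x₀| < δ/2}` is an interval of length `≤ δ/|γ|` (γ ≠ 0). [folklore] -/
theorem volume_couplingSlab_le (γ δ : ℝ) (hγ : γ ≠ 0) :
    (volume : Measure (Fin 1 → ℝ)) {x | |γ * x 0| < δ / 2} ≤ ENNReal.ofReal (δ / |γ|) := by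
  have hγ' : 0 < |γ| := abs_pos.mpr hγ
  have hsub : {x : Fin 1 → ℝ | |γ * x 0| < δ / 2} ⊆
      Set.univ.pi fun _ : Fin 1 => Set.Ioo (-(δ / (2 * |γ|))) (δ / (2 * |γ|)) := by
    intro x hx
    simp only [Set.mem_setOf_eq, abs_mul] at hx
    have hx' : |x 0| < δ / (2 * |γ|) := by
      rw [lt_div_iff₀ (by positivity)]
      linarith
    rw [abs_lt] at hx'
    simp only [Set.mem_univ_pi, Set.mem_Ioo]
    intro i
    rw [Fin.eq_zero i]
    exact ⟨hx'.1, hx'.2⟩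
  refine (measure_mono hsub).trans ?_
  rw [volume_pi_pi]
  simp only [Real.volume_Ioo, Finset.prod_const, Finset.card_univ, Fintype.card_fin, pow_one]
  apply le_of_eq
  congr 1
  field_simp
  ring

/-- [cite: ImbrieJSP2016, eq. (1.3)] **Fubini bound at sub-coupling scale**:
`Leb{(h, Γ, J) ∈ [-1,1]^1 × [-1,1]^1 × [-1,1]^2 : |h₀ + J₀ + J₁| < δ/2 ∧ |γΓ₀| < δ/2} ≤ 4δ²/|γ|` (γ ≠ 0, δ ≥ 0):
an `h₀`-interval of length `δ` times a `Γ₀`-interval of length `δ/|γ|` over the bond square `[-1,1]²`. -/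
theorem volume_deepSlab_one_le (γ δ : ℝ) (hγ : γ ≠ 0) (hδ : 0 ≤ δ) :
    ((volume : Measure (Fin 1 → ℝ)).prod
        ((volume : Measure (Fin 1 → ℝ)).prod (volume : Measure (Fin (1 + 1) → ℝ))))
      ({t | |t.1 0 + t.2.2 0 + t.2.2 1| < δ / 2 ∧ |γ * t.2.1 0| < δ / 2} ∩
        (Set.univ.pi fun _ : Fin 1 => Set.Icc (-1 : ℝ) 1) ×ˢ
          ((Set.univ.pi fun _ : Fin 1 => Set.Icc (-1 : ℝ) 1) ×ˢ (Set.univ.pi fun _ : Fin (1 + 1) => Set.Icc (-1 : ℝ) 1)))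
      ≤ ENNReal.ofReal (4 * δ ^ 2 / |γ|) := by
  set C1 : Set (Fin 1 → ℝ) := Set.univ.pi fun _ : Fin 1 => Set.Icc (-1 : ℝ) 1 with hC1def
  set C2 : Set (Fin (1 + 1) → ℝ) := Set.univ.pi fun _ : Fin (1 + 1) => Set.Icc (-1 : ℝ) 1 with hC2def
  have hC1 : MeasurableSet C1 := MeasurableSet.univ_pi fun _ => measurableSet_Icc
  have hC2 : MeasurableSet C2 := MeasurableSet.univ_pi fun _ => measurableSet_Icc
  set s := {t : (Fin 1 → ℝ) × (Fin 1 → ℝ) × (Fin (1 + 1) → ℝ) |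
      |t.1 0 + t.2.2 0 + t.2.2 1| < δ / 2 ∧ |γ * t.2.1 0| < δ / 2} ∩ C1 ×ˢ (C1 ×ˢ C2) with hsdef
  have hf : Measurable fun t : (Fin 1 → ℝ) × (Fin 1 → ℝ) × (Fin (1 + 1) → ℝ) => |t.1 0 + t.2.2 0 + t.2.2 1| := by
    fun_prop
  have hg : Measurable fun t : (Fin 1 → ℝ) × (Fin 1 → ℝ) × (Fin (1 + 1) → ℝ) => |γ * t.2.1 0| := by
    fun_prop
  have hs : MeasurableSet s :=
    ((measurableSet_lt hf measurable_const).inter (measurableSet_lt hg measurable_const)).inter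
      (hC1.prod (hC1.prod hC2))
  -- the set of outer coordinates y = (Γ, J) that can contribute
  set D : Set ((Fin 1 → ℝ) × (Fin (1 + 1) → ℝ)) := {y | |γ * y.1 0| < δ / 2} ∩ C1 ×ˢ C2 with hDdef
  have hgy : Measurable fun y : (Fin 1 → ℝ) × (Fin (1 + 1) → ℝ) => |γ * y.1 0| := by fun_prop
  have hD : MeasurableSet D := (measurableSet_lt hgy measurable_const).inter (hC1.prod hC2)
  rw [Measure.prod_apply_symm hs]
  have hpt : ∀ y : (Fin 1 → ℝ) × (Fin (1 + 1) → ℝ),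
      (volume : Measure (Fin 1 → ℝ)) ((fun x => (x, y)) ⁻¹' s) ≤ D.indicator (fun _ => ENNReal.ofReal δ) y := by
    intro y
    by_cases hy : y ∈ D
    · rw [Set.indicator_of_mem hy]
      refine (measure_mono ?_).trans (volume_fieldSlab_le (y.2 0 + y.2 1) δ)
      intro x hx
      simp only [hsdef, Set.mem_preimage, Set.mem_inter_iff, Set.mem_setOf_eq] at hx
      simp only [Set.mem_setOf_eq, ← add_assoc]
      exact hx.1.1
    · rw [Set.indicator_of_notMem hy]
      have he : (fun x => (x, y)) ⁻¹' s = ∅ := by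
        ext x
        simp only [Set.mem_preimage, Set.mem_empty_iff_false, iff_false]
        intro hx
        apply hy
        simp only [hsdef, Set.mem_inter_iff, Set.mem_setOf_eq, Set.mem_prod] at hx
        simp only [hDdef, Set.mem_inter_iff, Set.mem_setOf_eq, Set.mem_prod]
        exact ⟨hx.1.2, hx.2.2.1, hx.2.2.2⟩
      rw [he, measure_empty]
  refine (lintegral_mono hpt).trans ?_
  rw [lintegral_indicator_const hD]
  have hDsub : D ⊆ {x : Fin 1 → ℝ | |γ * x 0| < δ / 2} ×ˢ C2 := by
    intro y hy
    simp only [hDdef, Set.mem_inter_iff, Set.mem_setOf_eq, Set.mem_prod] at hy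
    simp only [Set.mem_prod, Set.mem_setOf_eq]
    exact ⟨hy.1, hy.2.2⟩
  have hv2 : (volume : Measure (Fin (1 + 1) → ℝ)) C2 = ENNReal.ofReal 2 * ENNReal.ofReal 2 := by
    rw [hC2def, volume_pi_pi]
    simp only [Real.volume_Icc, Finset.prod_const, Finset.card_univ, Fintype.card_fin]
    norm_num [sq]
  have hDle : ((volume : Measure (Fin 1 → ℝ)).prod (volume : Measure (Fin (1 + 1) → ℝ))) D ≤
      ENNReal.ofReal (δ / |γ|) * (ENNReal.ofReal 2 * ENNReal.ofReal 2) := by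
    refine (measure_mono hDsub).trans ?_
    refine (Measure.prod_prod_le _ _).trans ?_
    rw [hv2]
    exact mul_le_mul' (volume_couplingSlab_le γ δ hγ) le_rfl
  calc ENNReal.ofReal δ * ((volume : Measure (Fin 1 → ℝ)).prod (volume : Measure (Fin (1 + 1) → ℝ))) D
      ≤ ENNReal.ofReal δ * (ENNReal.ofReal (δ / |γ|) * (ENNReal.ofReal 2 * ENNReal.ofReal 2)) :=
        mul_le_mul' le_rfl hDle
    _ = ENNReal.ofReal (4 * δ ^ 2 / |γ|) := by
        have hγ' : 0 ≤ δ / |γ| := div_nonneg hδ (abs_nonneg γ)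
        rw [← ENNReal.ofReal_mul (by norm_num), ← ENNReal.ofReal_mul hγ', ← ENNReal.ofReal_mul hδ]
        congr 1
        field_simp
        ring

/-- [cite: ImbrieJSP2016, eq. (1.3) and p. 1000] **the one-site block law below the coupling, kernel-checked from the laws to the
spectrum**: for admissible laws (densities `≤ ρ₀`), every position `a`, every `γ ≠ 0`, every `δ ≥ 0`:
`P(min-gap of the one-site box < δ) ≤ ρ₀⁴ · 4δ²/|γ|` — exponent 2, per-site constant ∝ 1/|γ| (audit lemma; LLA for n ≥ 2 untouched). -/
theorem boxMeasure_smallGap_one_deep_le {L : Laws} {ρ₀ : ℝ} (hL : L.Admissible ρ₀) (hρ : 0 ≤ ρ₀) (a : ℤ) (γ δ : ℝ)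
    (hγ : γ ≠ 0) (hδ : 0 ≤ δ) :
    L.boxMeasure a 1 {t | SmallGap γ δ (Params.ofTriple t)} ≤ ENNReal.ofReal (ρ₀ ^ 4 * (4 * δ ^ 2 / |γ|)) := by
  have h := boxMeasure_smallGap_le_of_volume hL hρ a 1 γ δ (4 * δ ^ 2 / |γ|)
    ((measure_mono (Set.inter_subset_inter_left _ (smallGap_one_subset_deep γ δ))).trans
      (volume_deepSlab_one_le γ δ hγ hδ))
  simpa using h

/-- [cite: ImbrieJSP2016, eq. (1.3)] both one-site bounds at once: `P ≤ min(ρ₀⁴·8δ, ρ₀⁴·4δ²/|γ|)` — linear above the scale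
`δ ≍ |γ|`, quadratic below it. -/
theorem boxMeasure_smallGap_one_le_min {L : Laws} {ρ₀ : ℝ} (hL : L.Admissible ρ₀) (hρ : 0 ≤ ρ₀) (a : ℤ) (γ δ : ℝ)
    (hγ : γ ≠ 0) (hδ : 0 ≤ δ) :
    L.boxMeasure a 1 {t | SmallGap γ δ (Params.ofTriple t)} ≤
      min (ENNReal.ofReal (ρ₀ ^ 4 * (8 * δ))) (ENNReal.ofReal (ρ₀ ^ 4 * (4 * δ ^ 2 / |γ|))) :=
  le_min (boxMeasure_smallGap_one_le hL hρ a γ δ hδ) (boxMeasure_smallGap_one_deep_le hL hρ a γ δ hγ hδ)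

/-- [cite: ImbrieJSP2016, eq. (1.3)] the deep one-site bound in the exact shape of the `n = 1` clause of
`DeepLLA L γ ν₁ K A Θ₁` with `ν₁ = 2`, `K = 4ρ₀⁴`, `A = 1` (every `Θ₁`; the depth restriction is not even used):
`P ≤ δ^2 · (4ρ₀⁴ γ^{-1})^1` for `γ > 0`.  (Only the clause `n = 1`; `DeepLLA` quantifies over all `n` and is NOT asserted.) -/
theorem deepLLA_clause_one {L : Laws} {ρ₀ : ℝ} (hL : L.Admissible ρ₀) (hρ : 0 ≤ ρ₀) (γ : ℝ) (hγ : 0 < γ) (a : ℤ) (δ : ℝ)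
    (hδ : 0 < δ) :
    L.boxMeasure a 1 {t | SmallGap γ δ (Params.ofTriple t)} ≤
      ENNReal.ofReal (δ ^ (2 : ℝ) * (4 * ρ₀ ^ 4 * γ ^ (-(1 : ℝ))) ^ (1 : ℕ)) := by
  have h := boxMeasure_smallGap_one_deep_le hL hρ a γ δ hγ.ne' hδ.le
  have e : ρ₀ ^ 4 * (4 * δ ^ 2 / |γ|) = δ ^ (2 : ℝ) * (4 * ρ₀ ^ 4 * γ ^ (-(1 : ℝ))) ^ (1 : ℕ) := by
    rw [pow_one, abs_of_pos hγ, Real.rpow_neg hγ.le, Real.rpow_one, Real.rpow_two]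
    field_simp
  rwa [e] at h

end DeepMonomer

end Literature.MathematicalPhysics.QuantumLattice.Imbrie2016
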